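import Summits.SmoothPoincare4.SmoothPoincare4.Theorems.SymplecticOrigamiGromovRecognitionRelEndStubTameJAux2
import Literature.Geometry.Symplectic.GromovR4RelEndProofs
import Literature.Geometry.Symplectic.SteinBall
import Mathlib
import HarnessLib

/-!
# Cayley–Hamilton for `ω₀`-symmetric positive endomorphisms of `ℝ⁴` (by computation)
(helper file 3 for stub `stub_tameJ` of line `cross-cap-laurent`, crux `GromovRecognitionRelEnd`,
item stmt-SmoothPoincare4-11009)

Let `A ∈ End(ℝ⁴)` be such that `g(a, b) := ω₀(a, A b)` is symmetric (`ω₀ = stdSymplecticForm`).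
Writing `ω₀(a, c) = ⟪a, -J₀ c⟫` (`J₀ = stdComplexStructure = i ⊕ i`, McDuff–Salamon (1.1.21))
gives `A = J₀ G` with `G := -J₀ A` symmetric for the Euclidean structure, positive definite when
`g` is. This file proves, by an explicit `4 × 4` matrix computation (`ring` on the ten free
entries of `G`, in the standard basis via `LinearMap.toMatrix`):

* `ch_of_stdSym` (registered helper sub-goal `helper_cayleyHamiltonStdSym`) — the Cayley–Hamilton
  relation `A⁴ + τ(A) A² + p(A) = 0` with the trace invariants `τ(A) = -tr(A²)/2`,
  `p(A) = τ²/2 - tr(A⁴)/4` of the previous helper file (the characteristic polynomial of the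
  `g`-skew `A` is even, and Newton's identities give `e₂ = τ`, `e₄ = p`);
* `pTrace_pos_of_stdSym` — `p(A) = det G > 0` (`Matrix.PosDef.det_pos`).

Everything is proved; no definition, no named fact.

References: D. McDuff, D. Salamon, *Introduction to Symplectic Topology*, 3rd ed. (2017), §1.1
(1.1.21), Prop. 2.5.6 [McDuffSalamon2017].
-/

noncomputable section

-- the registered namespace `Summit.SmoothPoincare4.SmoothPoincare4.Theorems…` repeats a component
set_option linter.dupNamespace false

open scoped Topology RealInnerProductSpace
open Matrix Literature.Geometry.Symplectic

namespace Summit.SmoothPoincare4.SmoothPoincare4.Theorems.GromovRecognitionRelEnd.CrossCapLaurent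

/-! ### Matrices of endomorphisms of `ℝ⁴` -/

section Bridge

variable (b : Module.Basis (Fin 4) ℝ (EuclideanSpace ℝ (Fin 4)))

/-- `A ↦ toMatrix b b A` is injective on `End(ℝ⁴)`. [folklore] -/
theorem toMatrix_coe_injective :
    Function.Injective fun A : EuclideanSpace ℝ (Fin 4) →L[ℝ] EuclideanSpace ℝ (Fin 4) ↦
      LinearMap.toMatrix b b (A : EuclideanSpace ℝ (Fin 4) →ₗ[ℝ] EuclideanSpace ℝ (Fin 4)) :=
  fun _ _ h ↦ ContinuousLinearMap.coe_injective ((LinearMap.toMatrix b b).injective h)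

/-- `toMatrix` of a product of continuous linear maps. [folklore] -/
theorem toMatrix_coe_mul (A B : EuclideanSpace ℝ (Fin 4) →L[ℝ] EuclideanSpace ℝ (Fin 4)) :
    LinearMap.toMatrix b b ((A * B : EuclideanSpace ℝ (Fin 4) →L[ℝ] EuclideanSpace ℝ (Fin 4)) :
        EuclideanSpace ℝ (Fin 4) →ₗ[ℝ] EuclideanSpace ℝ (Fin 4)) =
      LinearMap.toMatrix b b (A : EuclideanSpace ℝ (Fin 4) →ₗ[ℝ] EuclideanSpace ℝ (Fin 4)) *
        LinearMap.toMatrix b b (B : EuclideanSpace ℝ (Fin 4) →ₗ[ℝ] EuclideanSpace ℝ (Fin 4)) := by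
  rw [← LinearMap.toMatrix_mul]
  rfl

/-- `toMatrix` of a sum of continuous linear maps. [folklore] -/
theorem toMatrix_coe_add (A B : EuclideanSpace ℝ (Fin 4) →L[ℝ] EuclideanSpace ℝ (Fin 4)) :
    LinearMap.toMatrix b b ((A + B : EuclideanSpace ℝ (Fin 4) →L[ℝ] EuclideanSpace ℝ (Fin 4)) :
        EuclideanSpace ℝ (Fin 4) →ₗ[ℝ] EuclideanSpace ℝ (Fin 4)) =
      LinearMap.toMatrix b b (A : EuclideanSpace ℝ (Fin 4) →ₗ[ℝ] EuclideanSpace ℝ (Fin 4)) +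
        LinearMap.toMatrix b b (B : EuclideanSpace ℝ (Fin 4) →ₗ[ℝ] EuclideanSpace ℝ (Fin 4)) := by
  rw [← map_add]
  rfl

/-- `toMatrix` of a scalar multiple of a continuous linear map. [folklore] -/
theorem toMatrix_coe_smul (c : ℝ) (A : EuclideanSpace ℝ (Fin 4) →L[ℝ] EuclideanSpace ℝ (Fin 4)) :
    LinearMap.toMatrix b b ((c • A : EuclideanSpace ℝ (Fin 4) →L[ℝ] EuclideanSpace ℝ (Fin 4)) :
        EuclideanSpace ℝ (Fin 4) →ₗ[ℝ] EuclideanSpace ℝ (Fin 4)) =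
      c • LinearMap.toMatrix b b (A : EuclideanSpace ℝ (Fin 4) →ₗ[ℝ] EuclideanSpace ℝ (Fin 4)) := by
  rw [← map_smul]
  rfl

/-- `toMatrix` of the identity of `ℝ⁴`. [folklore] -/
theorem toMatrix_coe_one :
    LinearMap.toMatrix b b ((1 : EuclideanSpace ℝ (Fin 4) →L[ℝ] EuclideanSpace ℝ (Fin 4)) :
        EuclideanSpace ℝ (Fin 4) →ₗ[ℝ] EuclideanSpace ℝ (Fin 4)) = 1 := by
  rw [← LinearMap.toMatrix_one b]
  rfl

/-- `toMatrix` of the zero endomorphism. [folklore] -/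
theorem toMatrix_coe_zero :
    LinearMap.toMatrix b b ((0 : EuclideanSpace ℝ (Fin 4) →L[ℝ] EuclideanSpace ℝ (Fin 4)) :
        EuclideanSpace ℝ (Fin 4) →ₗ[ℝ] EuclideanSpace ℝ (Fin 4)) = 0 := by
  rw [← map_zero (LinearMap.toMatrix b b)]
  rfl

/-- The trace of an endomorphism of `ℝ⁴` is the trace of its matrix. [folklore] -/
theorem trace_coe_eq_trace_toMatrix (A : EuclideanSpace ℝ (Fin 4) →L[ℝ] EuclideanSpace ℝ (Fin 4)) :
    LinearMap.trace ℝ (EuclideanSpace ℝ (Fin 4))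
        (A : EuclideanSpace ℝ (Fin 4) →ₗ[ℝ] EuclideanSpace ℝ (Fin 4)) =
      (LinearMap.toMatrix b b (A : EuclideanSpace ℝ (Fin 4) →ₗ[ℝ] EuclideanSpace ℝ (Fin 4))).trace :=
  LinearMap.trace_eq_matrix_trace ℝ b _

/-- Entries in the standard basis: `toMatrix A i j = (A eⱼ)ᵢ`. [folklore] -/
theorem toMatrix_basisFun_apply (A : EuclideanSpace ℝ (Fin 4) →L[ℝ] EuclideanSpace ℝ (Fin 4))
    (i j : Fin 4) :
    LinearMap.toMatrix (EuclideanSpace.basisFun (Fin 4) ℝ).toBasis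
        (EuclideanSpace.basisFun (Fin 4) ℝ).toBasis
        (A : EuclideanSpace ℝ (Fin 4) →ₗ[ℝ] EuclideanSpace ℝ (Fin 4)) i j =
      A (EuclideanSpace.single j 1) i := by
  rw [LinearMap.toMatrix_apply, OrthonormalBasis.coe_toBasis,
    OrthonormalBasis.coe_toBasis_repr_apply, EuclideanSpace.basisFun_apply,
    EuclideanSpace.basisFun_repr]
  rfl

/-- In the standard basis, `toMatrix A *ᵥ x` is `A (toLp x)` read in coordinates. [folklore] -/
theorem toMatrix_basisFun_mulVec (A : EuclideanSpace ℝ (Fin 4) →L[ℝ] EuclideanSpace ℝ (Fin 4))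
    (x : Fin 4 → ℝ) :
    LinearMap.toMatrix (EuclideanSpace.basisFun (Fin 4) ℝ).toBasis
        (EuclideanSpace.basisFun (Fin 4) ℝ).toBasis
        (A : EuclideanSpace ℝ (Fin 4) →ₗ[ℝ] EuclideanSpace ℝ (Fin 4)) *ᵥ x =
      fun i ↦ A (WithLp.toLp 2 x) i := by
  have hrepr : ∀ v : EuclideanSpace ℝ (Fin 4),
      ⇑((EuclideanSpace.basisFun (Fin 4) ℝ).toBasis.repr v) = fun i ↦ v i := fun v ↦ by
    funext i
    rw [OrthonormalBasis.coe_toBasis_repr_apply, EuclideanSpace.basisFun_repr]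
  have h := LinearMap.toMatrix_mulVec_repr (EuclideanSpace.basisFun (Fin 4) ℝ).toBasis
    (EuclideanSpace.basisFun (Fin 4) ℝ).toBasis
    (A : EuclideanSpace ℝ (Fin 4) →ₗ[ℝ] EuclideanSpace ℝ (Fin 4)) (WithLp.toLp 2 x)
  rw [hrepr, hrepr] at h
  exact h

/-- The matrix of `J₀ = i ⊕ i` (`stdComplexStructure`) in the standard basis. [folklore] -/
theorem toMatrix_stdComplexStructure :
    LinearMap.toMatrix (EuclideanSpace.basisFun (Fin 4) ℝ).toBasis
        (EuclideanSpace.basisFun (Fin 4) ℝ).toBasis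
        ((stdComplexStructure : EuclideanSpace ℝ (Fin 4) →L[ℝ] EuclideanSpace ℝ (Fin 4)) :
          EuclideanSpace ℝ (Fin 4) →ₗ[ℝ] EuclideanSpace ℝ (Fin 4)) =
      !![0, -1, 0, 0; 1, 0, 0, 0; 0, 0, 0, -1; 0, 0, 1, 0] := by
  ext i j
  rw [toMatrix_basisFun_apply]
  fin_cases i <;> fin_cases j <;> simp

end Bridge

/-! ### The brute-force identities for `M = J₀ G`, `G` symmetric -/

/-- A `4 × 4` matrix with symmetric entries, displayed through its ten upper entries. [folklore] -/
theorem eq_of_symm_entries (G : Matrix (Fin 4) (Fin 4) ℝ) (hG : ∀ i j, G i j = G j i) :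
    G = !![G 0 0, G 0 1, G 0 2, G 0 3; G 0 1, G 1 1, G 1 2, G 1 3; G 0 2, G 1 2, G 2 2, G 2 3;
      G 0 3, G 1 3, G 2 3, G 3 3] := by
  ext i j
  fin_cases i <;> fin_cases j <;> first | rfl | exact hG _ _

set_option maxHeartbeats 4000000 in
-- a `ring` normalisation of sixteen degree-four polynomial identities in ten variables
/-- **Cayley–Hamilton for `M = J₀ G`, `G` symmetric (by computation)**:
`M⁴ + τ M² + p = 0` with `τ = -tr(M²)/2`, `p = τ²/2 - tr(M⁴)/4`. (The characteristic polynomial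
of `J₀ G` is even — `J₀ G` is skew for `⟨·, G ·⟩` — so it reads `X⁴ + e₂ X² + e₄`, and Newton's
identities with `e₁ = 0` give `e₂ = -p₂/2`, `e₄ = e₂²/2 - p₄/4`.) [folklore] -/
theorem cayleyHamilton_J0_mul_symm (M G : Matrix (Fin 4) (Fin 4) ℝ) (hG : ∀ i j, G i j = G j i)
    (hM : M = !![0, -1, 0, 0; 1, 0, 0, 0; 0, 0, 0, -1; 0, 0, 1, 0] * G) :
    M * M * (M * M) + (-(M * M).trace / 2) • (M * M) +
      ((-(M * M).trace / 2) ^ 2 / 2 - (M * M * (M * M)).trace / 4) •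
        (1 : Matrix (Fin 4) (Fin 4) ℝ) = 0 := by
  subst hM
  rw [eq_of_symm_entries G hG]
  ext x y
  fin_cases x <;> fin_cases y <;> simp [Matrix.trace, Fin.sum_univ_four] <;> ring

set_option maxHeartbeats 4000000 in
-- a `ring` normalisation of a degree-four polynomial identity in ten variables
/-- **`p(J₀ G) = det G`** for `G` symmetric (by computation; `det J₀ = 1`). [folklore] -/
theorem pTrace_J0_mul_symm_eq_det (M G : Matrix (Fin 4) (Fin 4) ℝ) (hG : ∀ i j, G i j = G j i)
    (hM : M = !![0, -1, 0, 0; 1, 0, 0, 0; 0, 0, 0, -1; 0, 0, 1, 0] * G) :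
    (-(M * M).trace / 2) ^ 2 / 2 - (M * M * (M * M)).trace / 4 = G.det := by
  subst hM
  conv_rhs => rw [eq_of_symm_entries G hG]
  rw [eq_of_symm_entries G hG]
  simp [Matrix.trace, Matrix.det_succ_row_zero, Fin.sum_univ_succ, Fin.succAbove]
  ring

/-! ### `ω₀`-symmetric positive endomorphisms of `ℝ⁴` -/

/-- `ω₀(a, c) = ⟪a, -J₀ c⟫`: the Euclidean endomorphism representing `ω₀` is `-J₀`
(McDuff–Salamon 2017, (1.1.21): `ω₀(ζ, ζ') = ⟨J₀ ζ, ζ'⟩`). [cite: McDuffSalamon2017, §1.1 (1.1.21)] -/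
theorem stdSymplecticForm_eq_inner_neg_stdComplexStructure (a c : EuclideanSpace ℝ (Fin 4)) :
    stdSymplecticForm a c = ⟪a, -stdComplexStructure c⟫ := by
  rw [Literature.Topology.FourManifolds.inner_fin_four]
  simp only [stdSymplecticForm, PiLp.neg_apply, stdComplexStructure_apply_zero,
    stdComplexStructure_apply_one, stdComplexStructure_apply_two,
    stdComplexStructure_apply_three]
  ring

/-- `J₀² = -1` in `End(ℝ⁴)`. [folklore] -/
theorem stdComplexStructure_mul_self :
    (stdComplexStructure : EuclideanSpace ℝ (Fin 4) →L[ℝ] EuclideanSpace ℝ (Fin 4)) *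
      stdComplexStructure = -1 := by
  ext v i
  show (stdComplexStructure (stdComplexStructure v)) i = (-v) i
  rw [stdComplexStructure_sq]

/-- `⟪a, (-J₀ A) b⟫ = ω₀(a, A b)`. [folklore] -/
theorem inner_neg_stdComplexStructure_mul (A : EuclideanSpace ℝ (Fin 4) →L[ℝ] EuclideanSpace ℝ (Fin 4))
    (a c : EuclideanSpace ℝ (Fin 4)) :
    ⟪a, (-(stdComplexStructure * A)) c⟫ = stdSymplecticForm a (A c) := by
  rw [stdSymplecticForm_eq_inner_neg_stdComplexStructure]
  rfl

/-- `A = J₀ (-J₀ A)`. [folklore] -/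
theorem eq_stdComplexStructure_mul (A : EuclideanSpace ℝ (Fin 4) →L[ℝ] EuclideanSpace ℝ (Fin 4)) :
    A = stdComplexStructure * -(stdComplexStructure * A) := by
  rw [mul_neg stdComplexStructure (stdComplexStructure * A),
    ← mul_assoc stdComplexStructure stdComplexStructure A, stdComplexStructure_mul_self, neg_one_mul A,
    neg_neg A]

section StdSym

variable {A : EuclideanSpace ℝ (Fin 4) →L[ℝ] EuclideanSpace ℝ (Fin 4)}
  (hsym : ∀ a c : EuclideanSpace ℝ (Fin 4), stdSymplecticForm a (A c) = stdSymplecticForm c (A a))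
include hsym

/-- For `ω₀(·, A ·)` symmetric, the matrix of `G = -J₀ A` has symmetric entries. [folklore] -/
theorem toMatrix_neg_stdComplexStructure_mul_symm (i j : Fin 4) :
    LinearMap.toMatrix (EuclideanSpace.basisFun (Fin 4) ℝ).toBasis
        (EuclideanSpace.basisFun (Fin 4) ℝ).toBasis
        ((-(stdComplexStructure * A) : EuclideanSpace ℝ (Fin 4) →L[ℝ] EuclideanSpace ℝ (Fin 4)) :
          EuclideanSpace ℝ (Fin 4) →ₗ[ℝ] EuclideanSpace ℝ (Fin 4)) i j =
      LinearMap.toMatrix (EuclideanSpace.basisFun (Fin 4) ℝ).toBasis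
        (EuclideanSpace.basisFun (Fin 4) ℝ).toBasis
        ((-(stdComplexStructure * A) : EuclideanSpace ℝ (Fin 4) →L[ℝ] EuclideanSpace ℝ (Fin 4)) :
          EuclideanSpace ℝ (Fin 4) →ₗ[ℝ] EuclideanSpace ℝ (Fin 4)) j i := by
  have key : ∀ i j : Fin 4, LinearMap.toMatrix (EuclideanSpace.basisFun (Fin 4) ℝ).toBasis
      (EuclideanSpace.basisFun (Fin 4) ℝ).toBasis
      ((-(stdComplexStructure * A) : EuclideanSpace ℝ (Fin 4) →L[ℝ] EuclideanSpace ℝ (Fin 4)) :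
        EuclideanSpace ℝ (Fin 4) →ₗ[ℝ] EuclideanSpace ℝ (Fin 4)) i j =
      stdSymplecticForm (EuclideanSpace.single i 1) (A (EuclideanSpace.single j 1)) := by
    intro i j
    rw [toMatrix_basisFun_apply, ← inner_neg_stdComplexStructure_mul, EuclideanSpace.inner_single_left]
    simp
  rw [key, key, hsym]

/-- **Cayley–Hamilton for an `ω₀`-symmetric endomorphism of `ℝ⁴`**: if `ω₀(a, A c)` is
symmetric in `a, c` then `A⁴ + τ(A) A² + p(A) 1 = 0` with `τ(A) = -tr(A²)/2`,
`p(A) = τ(A)²/2 - tr(A⁴)/4` (transport of `cayleyHamilton_J0_mul_symm` through `toMatrix`).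
[folklore] -/
theorem ch_of_stdSym :
    A * A * (A * A) +
        (-(LinearMap.trace ℝ (EuclideanSpace ℝ (Fin 4))
          ((A * A : EuclideanSpace ℝ (Fin 4) →L[ℝ] EuclideanSpace ℝ (Fin 4)) :
            EuclideanSpace ℝ (Fin 4) →ₗ[ℝ] EuclideanSpace ℝ (Fin 4))) / 2) • (A * A) +
      ((-(LinearMap.trace ℝ (EuclideanSpace ℝ (Fin 4))
            ((A * A : EuclideanSpace ℝ (Fin 4) →L[ℝ] EuclideanSpace ℝ (Fin 4)) :
              EuclideanSpace ℝ (Fin 4) →ₗ[ℝ] EuclideanSpace ℝ (Fin 4))) / 2) ^ 2 / 2 -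
          LinearMap.trace ℝ (EuclideanSpace ℝ (Fin 4))
            ((A * A * (A * A) : EuclideanSpace ℝ (Fin 4) →L[ℝ] EuclideanSpace ℝ (Fin 4)) :
              EuclideanSpace ℝ (Fin 4) →ₗ[ℝ] EuclideanSpace ℝ (Fin 4)) / 4) •
        (1 : EuclideanSpace ℝ (Fin 4) →L[ℝ] EuclideanSpace ℝ (Fin 4)) = 0 := by
  set b := (EuclideanSpace.basisFun (Fin 4) ℝ).toBasis with hb
  apply toMatrix_coe_injective b
  have hA : LinearMap.toMatrix b b (A : EuclideanSpace ℝ (Fin 4) →ₗ[ℝ] EuclideanSpace ℝ (Fin 4)) =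
      !![0, -1, 0, 0; 1, 0, 0, 0; 0, 0, 0, -1; 0, 0, 1, 0] *
        LinearMap.toMatrix b b ((-(stdComplexStructure * A) :
          EuclideanSpace ℝ (Fin 4) →L[ℝ] EuclideanSpace ℝ (Fin 4)) :
            EuclideanSpace ℝ (Fin 4) →ₗ[ℝ] EuclideanSpace ℝ (Fin 4)) := by
    conv_lhs => rw [eq_stdComplexStructure_mul A]
    rw [toMatrix_coe_mul, hb, toMatrix_stdComplexStructure]
  have hCH := cayleyHamilton_J0_mul_symm _ _ (toMatrix_neg_stdComplexStructure_mul_symm hsym) hA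
  dsimp only
  rw [toMatrix_coe_zero, toMatrix_coe_add, toMatrix_coe_add, toMatrix_coe_smul, toMatrix_coe_smul,
    toMatrix_coe_one]
  simp only [toMatrix_coe_mul, trace_coe_eq_trace_toMatrix b]
  exact hCH

/-- **`p(A) > 0`** for `ω₀(·, A ·)` symmetric and positive definite: `p(A) = det G` with
`G = -J₀ A` positive definite. [folklore] -/
theorem pTrace_pos_of_stdSym
    (hpos : ∀ a : EuclideanSpace ℝ (Fin 4), a ≠ 0 → 0 < stdSymplecticForm a (A a)) :
    0 < (-(LinearMap.trace ℝ (EuclideanSpace ℝ (Fin 4))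
            ((A * A : EuclideanSpace ℝ (Fin 4) →L[ℝ] EuclideanSpace ℝ (Fin 4)) :
              EuclideanSpace ℝ (Fin 4) →ₗ[ℝ] EuclideanSpace ℝ (Fin 4))) / 2) ^ 2 / 2 -
        LinearMap.trace ℝ (EuclideanSpace ℝ (Fin 4))
          ((A * A * (A * A) : EuclideanSpace ℝ (Fin 4) →L[ℝ] EuclideanSpace ℝ (Fin 4)) :
            EuclideanSpace ℝ (Fin 4) →ₗ[ℝ] EuclideanSpace ℝ (Fin 4)) / 4 := by
  set b := (EuclideanSpace.basisFun (Fin 4) ℝ).toBasis with hb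
  set G := LinearMap.toMatrix b b ((-(stdComplexStructure * A) :
    EuclideanSpace ℝ (Fin 4) →L[ℝ] EuclideanSpace ℝ (Fin 4)) :
      EuclideanSpace ℝ (Fin 4) →ₗ[ℝ] EuclideanSpace ℝ (Fin 4)) with hG
  have hGs : ∀ i j, G i j = G j i := toMatrix_neg_stdComplexStructure_mul_symm hsym
  have hA : LinearMap.toMatrix b b (A : EuclideanSpace ℝ (Fin 4) →ₗ[ℝ] EuclideanSpace ℝ (Fin 4)) =
      !![0, -1, 0, 0; 1, 0, 0, 0; 0, 0, 0, -1; 0, 0, 1, 0] * G := by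
    conv_lhs => rw [eq_stdComplexStructure_mul A]
    rw [toMatrix_coe_mul, hb, toMatrix_stdComplexStructure]
  have hp := pTrace_J0_mul_symm_eq_det _ _ hGs hA
  rw [trace_coe_eq_trace_toMatrix b, trace_coe_eq_trace_toMatrix b, toMatrix_coe_mul,
    toMatrix_coe_mul, toMatrix_coe_mul, hp]
  refine Matrix.PosDef.det_pos (Matrix.PosDef.of_dotProduct_mulVec_pos ?_ fun x hx ↦ ?_)
  · exact Matrix.isHermitian_iff_isSymm.2 (Matrix.IsSymm.ext fun i j ↦ hGs j i)
  · have hv : (WithLp.toLp 2 x : EuclideanSpace ℝ (Fin 4)) ≠ 0 := fun h ↦ hx (by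
      have := congrArg WithLp.ofLp h
      simpa using this)
    have := hpos _ hv
    rw [← inner_neg_stdComplexStructure_mul, Literature.Topology.FourManifolds.inner_fin_four] at this
    rw [hG, hb, toMatrix_basisFun_mulVec, star_trivial, dotProduct, Fin.sum_univ_four]
    simpa using this

end StdSym

/-! ### Registered helper sub-goal -/

/-- **Registered helper sub-goal `helper_cayleyHamiltonStdSym`** (`ch_of_stdSym`): an endomorphism
`A` of `ℝ⁴` for which `ω₀(a, A c)` is symmetric satisfies `A⁴ + τ(A) A² + p(A) = 0`,
`τ(A) = -tr(A²)/2`, `p(A) = τ(A)²/2 - tr(A⁴)/4`. [folklore] -/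
theorem helper_cayleyHamiltonStdSym :
    ∀ A : EuclideanSpace ℝ (Fin 4) →L[ℝ] EuclideanSpace ℝ (Fin 4),
    (∀ a c : EuclideanSpace ℝ (Fin 4), Literature.Geometry.Symplectic.stdSymplecticForm a (A c) =
      Literature.Geometry.Symplectic.stdSymplecticForm c (A a)) →
    A * A * (A * A) +
        (-(LinearMap.trace ℝ (EuclideanSpace ℝ (Fin 4))
          ((A * A : EuclideanSpace ℝ (Fin 4) →L[ℝ] EuclideanSpace ℝ (Fin 4)) :
            EuclideanSpace ℝ (Fin 4) →ₗ[ℝ] EuclideanSpace ℝ (Fin 4))) / 2) • (A * A) +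
      ((-(LinearMap.trace ℝ (EuclideanSpace ℝ (Fin 4))
            ((A * A : EuclideanSpace ℝ (Fin 4) →L[ℝ] EuclideanSpace ℝ (Fin 4)) :
              EuclideanSpace ℝ (Fin 4) →ₗ[ℝ] EuclideanSpace ℝ (Fin 4))) / 2) ^ 2 / 2 -
          LinearMap.trace ℝ (EuclideanSpace ℝ (Fin 4))
            ((A * A * (A * A) : EuclideanSpace ℝ (Fin 4) →L[ℝ] EuclideanSpace ℝ (Fin 4)) :
              EuclideanSpace ℝ (Fin 4) →ₗ[ℝ] EuclideanSpace ℝ (Fin 4)) / 4) •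
        (1 : EuclideanSpace ℝ (Fin 4) →L[ℝ] EuclideanSpace ℝ (Fin 4)) = 0 :=
  fun _ hsym ↦ ch_of_stdSym hsym

end Summit.SmoothPoincare4.SmoothPoincare4.Theorems.GromovRecognitionRelEnd.CrossCapLaurent

end
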